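import Mathlib.Analysis.Calculus.ContDiff.FaaDiBruno
import HarnessLib

/-!
# Factorial-weighted counts of ordered finpartitions (Lah numbers) and the exponential-formula
# identity `Σ_c |c|!·x^{|c|}·Π (partSize)! = n!·x·(1+x)^{n−1}`

Analysis/Calculus proof file (theorems only; no definitions, no named facts), over Mathlib's
`OrderedFinpartition n` — the index set of the Faà di Bruno formula
(`iteratedFDeriv_comp` / `FormalMultilinearSeries.taylorComp`). We prove:
* (`Σᵢ partSize i = n`, private) the behaviour of the weight
  `Πᵢ (partSize i)!` under the two extension moves of `OrderedFinpartition.extendEquiv`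
  (`prod_factorial_partSize_extendLeft/_extendMiddle`);
* the **Lah recurrence** for `L(n,k) := Σ_{c : |c| = k} Πᵢ (partSize i)!` (the number of partitions of
  `n` labelled points into `k` linearly ordered blocks): `L(n+1, k+1) = L(n, k) + (n + k + 1)·L(n, k+1)`
  (`lahSum_succ_succ`), and the closed form `(k+1)!·L(n+1, k+1) = (n+1)!·C(n, k)` (`factorial_mul_lahSum`);
* the **exponential-formula identity** `Σ_{c : OrderedFinpartition (n+1)} |c|!·x^{|c|}·Πᵢ(partSize i)! =
  (n+1)!·x·(1+x)^n` (`sum_factorial_length_mul_pow_mul_prod_factorial_partSize`) — Armstrong–Vicol's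
  Lemma 7.4 (`β! Σ_{1≤|α|≤n} R^{|α|}|α|! Σ_s Σ_{p_s(β,α)} Π (|l_j|!)^{|k_j|}/(k_j!(l_j!)^{|k_j|}) = dR(1+dR)^{n−1} n!`)
  in the total-order bookkeeping of Mathlib's Faà di Bruno formula; it is the combinatorial core of the
  analytic composition estimate (their Prop. 7.6);
* the **shifted-factorial weights** identity `Σ_{c} |c|!·Πᵢ p|cᵢ| = Π_{j≤n}(j + b)` whenever `p 1 = b`,
  `p(s+1) = (s − b) p s` (`sum_factorial_length_mul_prod_eq_prod_range`) — Armstrong–Vicol's Lemma 7.3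
  (`binom(½,·)` re-summation, `b = ½`) in total-order form, the combinatorial core of their Prop. 7.11.

## References

* S. Armstrong, V. Vicol, *Anomalous diffusion by fractal homogenization*, Ann. PDE 11 (2025),
  arXiv:2305.05048, App. A Lemma 7.4 and Prop. 7.2 (Faà di Bruno). [`ArmstrongVicol2025`]
* L. Comtet, *Advanced Combinatorics* (Reidel 1974), Ch. III §3.3 (exponential formula; Lah numbers
  `L(n,k) = C(n−1,k−1) n!/k!`). [`Comtet1974`]
-/

open Finset
open scoped Nat

namespace OrderedFinpartition

variable {n : ℕ}

/-! ## §1 Sizes and the factorial weight under extension -/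

/-- The part sizes of an ordered finpartition of `n` points add up to `n` (also
`OrderedFinpartition.sum_partSize` of `Literature/NumberTheory/LFunctions/LiCriterion.lean`, not imported
here to keep this file light). [folklore] -/
private theorem sum_partSize' (c : OrderedFinpartition n) : ∑ i, c.partSize i = n := by
  have h := Fintype.card_congr c.equivSigma
  simpa [Fintype.card_sigma] using h

/-- Adding a new singleton part does not change the factorial weight `Πᵢ (partSize i)!`.
[cite: Comtet1974, Ch. III §3.3] -/
theorem prod_factorial_partSize_extendLeft (c : OrderedFinpartition n) :
    ∏ i, ((c.extendLeft).partSize i)! = ∏ i, (c.partSize i)! := by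
  show ∏ i : Fin (c.length + 1), (Fin.cons (α := fun _ => ℕ) 1 c.partSize i)! = _
  rw [Fin.prod_univ_succ]
  simp

/-- Enlarging the `i`-th part by one point multiplies the factorial weight by `partSize i + 1`.
[cite: Comtet1974, Ch. III §3.3] -/
theorem prod_factorial_partSize_extendMiddle (c : OrderedFinpartition n) (i : Fin c.length) :
    ∏ m, ((c.extendMiddle i).partSize m)! = (c.partSize i + 1) * ∏ m, (c.partSize m)! := by
  show ∏ m : Fin c.length, (Function.update c.partSize i (c.partSize i + 1) m)! = _
  rw [show (fun m => (Function.update c.partSize i (c.partSize i + 1) m)!) =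
      Function.update (fun m => (c.partSize m)!) i ((c.partSize i + 1)!) from by
    funext m; by_cases hm : m = i
    · subst hm; simp
    · simp [Function.update_of_ne hm]]
  rw [Finset.prod_update_of_mem (Finset.mem_univ i), Finset.sdiff_singleton_eq_erase,
    ← Finset.mul_prod_erase Finset.univ (fun m => (c.partSize m)!) (Finset.mem_univ i), Nat.factorial_succ]
  ring

/-- Sums over `OrderedFinpartition (n+1)` via the extension bijection `extendEquiv`: every ordered
finpartition of `n+1` points is obtained exactly once from one of `n` points by adding a new singleton
part or by enlarging one part. [cite: Comtet1974, Ch. III §3.3] -/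
theorem sum_eq_sum_extend {M : Type*} [AddCommMonoid M] (f : OrderedFinpartition (n + 1) → M) :
    ∑ c, f c = ∑ c : OrderedFinpartition n, (f c.extendLeft + ∑ i : Fin c.length, f (c.extendMiddle i)) := by
  rw [← (extendEquiv n).sum_comp, Fintype.sum_sigma]
  refine Finset.sum_congr rfl fun c _ => ?_
  rw [Fintype.sum_option]
  rfl

/-! ## §2 Lah numbers: the factorial-weighted count by number of parts -/

/-- No ordered finpartition of `n + 1` points has zero parts. [cite: Comtet1974, Ch. III §3.3] -/
theorem lahSum_zero (n : ℕ) :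
    (∑ c : OrderedFinpartition (n + 1), if c.length = 0 then ∏ i, (c.partSize i)! else 0) = 0 := by
  refine Finset.sum_eq_zero fun c _ => ?_
  have h : 0 < c.length := c.length_pos (Nat.succ_pos n)
  rw [if_neg (by omega)]

/-- The partition of `0` points: only the empty partition, of length `0` and weight `1`.
[cite: Comtet1974, Ch. III §3.3] -/
theorem lahSum_base (k : ℕ) :
    (∑ c : OrderedFinpartition 0, if c.length = k then ∏ i, (c.partSize i)! else 0) = if k = 0 then 1 else 0 := by
  rw [Fintype.sum_unique, Unique.eq_default (default : OrderedFinpartition 0)]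
  simp only [default_eq, atomic]
  by_cases hk : k = 0
  · subst hk; simp
  · rw [if_neg (Ne.symm hk), if_neg hk]

/-- **The Lah recurrence** `L(n+1, k+1) = L(n, k) + (n + k + 1) · L(n, k+1)` for
`L(n, k) = Σ_{c : OrderedFinpartition n, |c| = k} Πᵢ (partSize i)!`: a partition of `n+1` points into
`k+1` ordered blocks either has the new point as a singleton block (from `L(n,k)`) or inserts it into
one of the `k+1` blocks of a partition of the other `n` points, in `n + k + 1` ways in total.
[cite: Comtet1974, Ch. III §3.3 (Lah numbers)] -/
theorem lahSum_succ_succ (n k : ℕ) :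
    (∑ c : OrderedFinpartition (n + 1), if c.length = k + 1 then ∏ i, (c.partSize i)! else 0) =
      (∑ c : OrderedFinpartition n, if c.length = k then ∏ i, (c.partSize i)! else 0) +
        (n + k + 1) * ∑ c : OrderedFinpartition n, if c.length = k + 1 then ∏ i, (c.partSize i)! else 0 := by
  rw [sum_eq_sum_extend, Finset.sum_add_distrib, Finset.mul_sum]
  congr 1
  · refine Finset.sum_congr rfl fun c _ => ?_
    rw [prod_factorial_partSize_extendLeft]
    by_cases hc : c.length = k
    · rw [if_pos (by rw [extendLeft_length, hc]), if_pos hc]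
    · rw [if_neg (by rw [extendLeft_length]; omega), if_neg hc]
  · refine Finset.sum_congr rfl fun c _ => ?_
    simp only [extendMiddle_length, prod_factorial_partSize_extendMiddle]
    by_cases hc : c.length = k + 1
    · simp only [hc, if_true]
      rw [← Finset.sum_mul, Finset.sum_add_distrib, sum_partSize', Finset.sum_const, Finset.card_univ,
        Fintype.card_fin, smul_eq_mul, mul_one]
      have h' : n + c.length = n + k + 1 := by rw [hc]; ring
      rw [h']
    · simp only [hc, if_false, Finset.sum_const_zero, mul_zero]

/-- **Closed form of the Lah numbers**: `(k+1)! · L(n+1, k+1) = (n+1)! · C(n, k)`.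
[cite: Comtet1974, Ch. III §3.3 (L(n,k) = C(n−1,k−1)·n!/k!)] -/
theorem factorial_mul_lahSum (n k : ℕ) :
    (k + 1)! * (∑ c : OrderedFinpartition (n + 1), if c.length = k + 1 then ∏ i, (c.partSize i)! else 0) =
      (n + 1)! * n.choose k := by
  induction n generalizing k with
  | zero =>
    have h := lahSum_succ_succ 0 k
    rw [lahSum_base, lahSum_base, if_neg (Nat.succ_ne_zero k), mul_zero, add_zero] at h
    rw [h]
    cases k with
    | zero => simp
    | succ k => rw [if_neg (Nat.succ_ne_zero k)]; simp
  | succ n ih =>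
    have hrec := lahSum_succ_succ (n + 1) k
    cases k with
    | zero =>
      rw [lahSum_zero, zero_add] at hrec
      have h1 := ih 0
      -- atoms
      set A := ∑ c : OrderedFinpartition (n + 1), if c.length = 0 + 1 then ∏ i, (c.partSize i)! else 0
      set B := ∑ c : OrderedFinpartition (n + 1 + 1), if c.length = 0 + 1 then ∏ i, (c.partSize i)! else 0
      rw [hrec, Nat.choose_zero_right, Nat.factorial_succ (n + 1)]
      rw [Nat.choose_zero_right] at h1
      have e : (0 + 1)! = 1 := rfl
      rw [e] at h1 ⊢
      rw [one_mul] at h1 ⊢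
      rw [h1]; ring
    | succ k =>
      have h1 := ih k
      have h2 := ih (k + 1)
      rw [hrec, Nat.choose_succ_succ', Nat.factorial_succ (n + 1), Nat.factorial_succ (k + 1)]
      rw [Nat.factorial_succ (k + 1)] at h2
      set a := n.choose k
      set b := n.choose (k + 1)
      set A := ∑ c : OrderedFinpartition (n + 1), if c.length = k + 1 then ∏ i, (c.partSize i)! else 0
      set B := ∑ c : OrderedFinpartition (n + 1), if c.length = k + 1 + 1 then ∏ i, (c.partSize i)! else 0
      -- now a polynomial identity in the atoms, from `h1`, `h2` and the absorption identity
      rcases Nat.lt_or_ge n (k + 1) with hk | hk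
      · -- `b = 0`; and `a ≠ 0` forces `k = n`
        have hb : b = 0 := Nat.choose_eq_zero_of_lt hk
        rw [hb, mul_zero] at h2
        have hB : B = 0 := by
          rcases mul_eq_zero.mp h2 with h | h
          · exact absurd h (Nat.mul_ne_zero (Nat.succ_ne_zero _) (Nat.factorial_ne_zero _))
          · exact h
        rw [hB, hb, mul_zero, add_zero, add_zero]
        rcases Nat.lt_or_ge n k with hk' | hk'
        · have ha : a = 0 := Nat.choose_eq_zero_of_lt hk'
          rw [ha, mul_zero] at h1 ⊢
          rcases mul_eq_zero.mp h1 with h | h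
          · exact absurd h (Nat.factorial_ne_zero _)
          · rw [h, mul_zero]
        · have hkn : k = n := by omega
          subst hkn
          zify at h1 ⊢
          linear_combination ((k : ℤ) + 1 + 1) * h1
      · have ha := Nat.choose_succ_right_eq n k
        zify [hk, (by omega : k ≤ n)] at h1 h2 ha ⊢
        linear_combination ((k : ℤ) + 1 + 1) * h1 + ((n : ℤ) + 1 + (k + 1) + 1) * h2 + ((n + 1)! : ℤ) * ha

/-! ## §3 The exponential-formula identity -/

/-- **`Σ_{c : OrderedFinpartition (n+1)} |c|!·x^{|c|}·Πᵢ (partSize i)! = (n+1)!·x·(1+x)^n`** — the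
generating identity of the Lah numbers (`Σ_k k!·L(n,k)·x^k = n!·x·(1+x)^{n−1}`), i.e. Armstrong–Vicol's
Lemma 7.4 in the total-order bookkeeping of the Faà di Bruno index set.
[cite: ArmstrongVicol2025, App. A Lemma 7.4; Comtet1974, Ch. III §3.3] -/
theorem sum_factorial_length_mul_pow_mul_prod_factorial_partSize (n : ℕ) (x : ℝ) :
    ∑ c : OrderedFinpartition (n + 1), ((c.length)! : ℝ) * x ^ c.length * (∏ i, ((c.partSize i)! : ℝ)) =
      ((n + 1)! : ℝ) * x * (1 + x) ^ n := by
  -- group by the number of parts `k + 1 ∈ {1, …, n+1}`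
  have hgroup : ∀ c : OrderedFinpartition (n + 1),
      ((c.length)! : ℝ) * x ^ c.length * (∏ i, ((c.partSize i)! : ℝ)) =
        ∑ k ∈ Finset.range (n + 1), if c.length = k + 1 then
          ((k + 1)! : ℝ) * x ^ (k + 1) * (∏ i, ((c.partSize i)! : ℝ)) else 0 := by
    intro c
    have h0 : 0 < c.length := c.length_pos (Nat.succ_pos n)
    have hle : c.length ≤ n + 1 := c.length_le
    rw [Finset.sum_eq_single (c.length - 1)]
    · have e : c.length - 1 + 1 = c.length := by omega
      rw [if_pos e.symm]
      rw [e]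
    · intro k _ hk
      rw [if_neg (by omega)]
    · intro hk
      exact absurd (Finset.mem_range.2 (by omega)) hk
  rw [Finset.sum_congr rfl fun c _ => hgroup c, Finset.sum_comm]
  -- evaluate each group with the Lah closed form
  have hk : ∀ k ∈ Finset.range (n + 1),
      (∑ c : OrderedFinpartition (n + 1), if c.length = k + 1 then
          ((k + 1)! : ℝ) * x ^ (k + 1) * (∏ i, ((c.partSize i)! : ℝ)) else 0) =
        ((n + 1)! : ℝ) * (n.choose k : ℝ) * x ^ (k + 1) := by
    intro k _
    have h := congrArg (Nat.cast : ℕ → ℝ) (factorial_mul_lahSum n k)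
    push_cast at h
    rw [Finset.mul_sum] at h
    rw [← h, Finset.sum_mul]
    refine Finset.sum_congr rfl fun c _ => ?_
    split_ifs <;> ring
  rw [Finset.sum_congr rfl hk]
  -- binomial theorem
  rw [add_comm (1 : ℝ) x, add_pow x 1 n, Finset.mul_sum]
  refine Finset.sum_congr rfl fun k _ => ?_
  rw [one_pow, mul_one, pow_succ]
  ring

/-! ## §4 Shifted-factorial weights (Armstrong–Vicol Lemma 7.3 in total-order form) -/

/-- A general weight under the singleton extension: `Πᵢ g(|extendLeft c|ᵢ) = g 1 · Πᵢ g(|cᵢ|)`.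
[cite: Comtet1974, Ch. III §3.3] -/
theorem prod_partSize_extendLeft {M : Type*} [CommMonoid M] (c : OrderedFinpartition n) (g : ℕ → M) :
    ∏ i, g ((c.extendLeft).partSize i) = g 1 * ∏ i, g (c.partSize i) := by
  show ∏ i : Fin (c.length + 1), g (Fin.cons (α := fun _ => ℕ) 1 c.partSize i) = _
  rw [Fin.prod_univ_succ]
  simp

/-- A general weight under the enlargement of part `i`:
`Π_m g(|extendMiddle c i|_m) = g(|cᵢ|+1) · Π_{m ≠ i} g(|c_m|)`. [cite: Comtet1974, Ch. III §3.3] -/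
theorem prod_partSize_extendMiddle {M : Type*} [CommMonoid M] (c : OrderedFinpartition n) (i : Fin c.length)
    (g : ℕ → M) :
    ∏ m, g ((c.extendMiddle i).partSize m) = g (c.partSize i + 1) * ∏ m ∈ Finset.univ.erase i, g (c.partSize m) := by
  show ∏ m : Fin c.length, g (Function.update c.partSize i (c.partSize i + 1) m) = _
  rw [show (fun m => g (Function.update c.partSize i (c.partSize i + 1) m)) =
      Function.update (fun m => g (c.partSize m)) i (g (c.partSize i + 1)) from by
    funext m; by_cases hm : m = i
    · subst hm; simp
    · simp [Function.update_of_ne hm]]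
  rw [Finset.prod_update_of_mem (Finset.mem_univ i), Finset.sdiff_singleton_eq_erase]

/-- **Shifted-factorial weights** — Armstrong–Vicol's Lemma 7.3 (the `binom(½, ·)` re-summation) in the
total-order bookkeeping: if `p 1 = b` and `p (s+1) = (s − b)·p s` for `s ≥ 1` (e.g.
`p s = (−1)^{s−1} binom(½, s)·s!`, `b = ½`), then
`Σ_{c : OrderedFinpartition (n+1)} |c|! · Πᵢ p |cᵢ| = Π_{j=0}^{n} (j + b)`
(each extension step multiplies the total weight by `n + 1 + b`, independently of the number of parts).
[cite: ArmstrongVicol2025, App. A Lemma 7.3; Comtet1974, Ch. III §3.4] -/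
theorem sum_factorial_length_mul_prod_eq_prod_range (p : ℕ → ℝ) (b : ℝ) (h1 : p 1 = b)
    (hrec : ∀ s : ℕ, 1 ≤ s → p (s + 1) = ((s : ℝ) - b) * p s) :
    ∀ n : ℕ, ∑ c : OrderedFinpartition (n + 1), ((c.length)! : ℝ) * ∏ i, p (c.partSize i) =
      ∏ j ∈ Finset.range (n + 1), ((j : ℝ) + b)
  | 0 => by
    rw [sum_eq_sum_extend, Fintype.sum_unique, Unique.eq_default (default : OrderedFinpartition 0)]
    simp only [default_eq]
    rw [prod_partSize_extendLeft, extendLeft_length]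
    simp [atomic, h1]
  | n + 1 => by
    have ih := sum_factorial_length_mul_prod_eq_prod_range p b h1 hrec n
    rw [Finset.prod_range_succ, ← ih, Finset.sum_mul, sum_eq_sum_extend]
    refine Finset.sum_congr rfl fun c _ => ?_
    -- the singleton extension contributes `(k+1)·b·w(c)`, enlarging part `i` contributes `(|cᵢ| − b)·w(c)`
    have hL : (((c.extendLeft).length)! : ℝ) * ∏ i, p ((c.extendLeft).partSize i) =
        ((c.length : ℝ) + 1) * b * (((c.length)! : ℝ) * ∏ i, p (c.partSize i)) := by
      rw [prod_partSize_extendLeft, extendLeft_length, Nat.factorial_succ, h1]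
      push_cast
      ring
    have hM : ∀ i : Fin c.length, (((c.extendMiddle i).length)! : ℝ) * ∏ m, p ((c.extendMiddle i).partSize m) =
        ((c.partSize i : ℝ) - b) * (((c.length)! : ℝ) * ∏ m, p (c.partSize m)) := by
      intro i
      rw [prod_partSize_extendMiddle, extendMiddle_length, hrec _ (c.partSize_pos i),
        ← Finset.mul_prod_erase Finset.univ (fun m => p (c.partSize m)) (Finset.mem_univ i)]
      ring
    rw [hL, Finset.sum_congr rfl fun i _ => hM i, ← Finset.sum_mul, Finset.sum_sub_distrib, Finset.sum_const,
      Finset.card_univ, Fintype.card_fin, nsmul_eq_mul]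
    have hs : ∑ i, (c.partSize i : ℝ) = (n : ℝ) + 1 := by exact_mod_cast sum_partSize' c
    rw [hs]
    push_cast
    ring

end OrderedFinpartition
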